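import Mathlib.FieldTheory.Normal.Closure
import Mathlib.NumberTheory.NumberField.ClassNumber
import Literature.NumberTheory.EllipticCurves.ZpExtensionRestrictLayers
import HarnessLib

set_option autoImplicit false

/-!
# The layers of a restricted `ℤ_p`-extension are the composita: `(M·F_∞)_n ≅ j(M)·F_n ⊆ F̄`

Topic `Literature/NumberTheory/EllipticCurves` (companion of `ZpExtensionRestrict.lean`, `ZpExtensionRestrictLayers.lean`).
THEOREM-ONLY file (no definition, no named fact, no `sorry`), written by the literature seat `bsd-potss-conjA-anchor`
g11 (cell `bsd-potss`; supports stmt-BirchSwinnertonDyer-19386 / 19413): step (4)–(5) of the tower identification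
`(L^H)_n = (L_n)^H` that the μ-descent theorems of `Literature/NumberTheory/IwasawaTheory/ClassicalMuVanishesDescent.lean`
take as a displayed hypothesis.

Setting: `κ` a `ℤ_p`-extension of a number field `F` with layers `F_n = κ.layer n ⊆ F̄` (`F̄ = AlgebraicClosure F`),
`M/F` a finite extension with `κ ∘ res` surjective (e.g. `p ∤ [M : F]`), `κ_M = κ.restrict M h` the tower `M·F_∞/M`
(its layers `κ_M.layer n ⊆ M̄` live in ANOTHER algebraic closure), and `j : M →ₐ[F] F̄` ANY `F`-embedding.  Washington,
*Introduction to Cyclotomic Fields*, §13.1 (`K_∞L/L`, with layers `LK_n` when `L ∩ K_∞ = K`):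

* `exists_algEquiv_apply_eq` — two `F`-embeddings `j₁, j₂ : M → F̄` differ by an element of `Gal(F̄/F)` (extension of
  `F`-homomorphisms to the normal extension `F̄/F`; Milne, *Fields and Galois Theory*, Ch. 7: the absolute Galois
  group / embeddings into `F̄` are defined up to `Gal(F̄/F)`).
* `mem_fieldRange_sup_layer_iff` — `y ∈ e(M)·F_n ⊆ F̄` iff `y` is fixed by every `res τ`, `τ ∈ Γ_M`, with
  `κ(res τ) ∈ pⁿℤ_p` (here `e = absEmbedding F M` is the copy of `M` in `F̄` cut out by `res(Γ_M)`; Krull–Galois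
  correspondence for `F̄/F`, `IntermediateField.fixingSubgroup_sup`).
* `absClosureEquiv_mem_layer_restrict_iff` — the same condition says `ι y ∈ (M·F_∞)_n ⊆ M̄` for the chosen
  `ι : F̄ ≅ M̄` (`absClosureEquiv`), by `Gal(M̄/(M F_∞)_n) = res⁻¹ Gal(F̄/F_n)` (`layerSubgroup_restrict`).
* `nonempty_ringEquiv_layer_restrict_fieldRange_sup_layer` — **`(κ.restrict M h).layer n ≃+* ↥(j.fieldRange ⊔ κ.layer n)`**
  for EVERY `F`-embedding `j : M → F̄`: the `n`-th layer of `M·F_∞/M` is the compositum `j(M)·F_n` in `F̄` (for `j = e` by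
  the two bullets above and `ι`; for general `j` conjugate by the `τ ∈ Gal(F̄/F)` with `τ ∘ e = j`, which fixes the normal
  subfield `F_n`: `IntermediateField.normal_iff_forall_map_eq'`).
* `natCard_classGroup_layer_restrict_eq` — hence **`#Cl((M·F_∞)_n) = #Cl(j(M)·F_n)`** (`ClassGroup.mulEquiv`), the form in
  which the class-number relations of a layer `L·F_n/F_n` (Kuroda, norm relations: `(L·F_n)^{H} = L^{H}·F_n`) are read as
  relations between the exponents `e_n` of the restricted towers (`IwasawaTheory.classNumberPExp`).

References: [Washington1997] L. Washington, *Introduction to Cyclotomic Fields*, 2nd ed., §13.1; [MilneFT2022] J. S. Milne,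
*Fields and Galois Theory*, Ch. 7 (and Ch. 3, extension of embeddings to normal extensions).
-/

noncomputable section

open scoped NumberField

open Field IntermediateField Literature.NumberTheory.GaloisRepresentations

universe u v

namespace Literature.NumberTheory.EllipticCurves.ZpExtension

variable {F : Type u} [Field F] {p : ℕ} [Fact p.Prime]

/-! ### §1 Embeddings into `F̄` are conjugate -/

omit [Fact p.Prime] in
/-- **Two `F`-embeddings `j₁ j₂ : M → F̄` differ by an automorphism of `F̄/F`**: `∃ τ ∈ Gal(F̄/F), τ ∘ j₁ = j₂`
(extend the `F`-isomorphism `j₁(M) ≅ M ≅→ j₂(M) ⊆ F̄` to the normal extension `F̄/F`, `AlgHom.liftNormal`; an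
`F`-endomorphism of `F̄` is an automorphism). [cite: MilneFT2022, Ch. 7 (embeddings into the algebraic closure are
conjugate under the absolute Galois group)] -/
theorem exists_algEquiv_apply_eq {M : Type v} [Field M] [Algebra F M] (j₁ j₂ : M →ₐ[F] AlgebraicClosure F) :
    ∃ τ : AlgebraicClosure F ≃ₐ[F] AlgebraicClosure F, ∀ m : M, τ (j₁ m) = j₂ m := by
  let e₁ : M ≃ₐ[F] j₁.fieldRange := AlgEquiv.ofInjectiveField j₁
  let ϕ : j₁.fieldRange →ₐ[F] AlgebraicClosure F := j₂.comp (e₁.symm : j₁.fieldRange →ₐ[F] M)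
  let χ : AlgebraicClosure F →ₐ[F] AlgebraicClosure F := ϕ.liftNormal (AlgebraicClosure F)
  refine ⟨AlgEquiv.ofBijective χ (Algebra.IsAlgebraic.algHom_bijective χ), fun m => ?_⟩
  have h1 : j₁ m = algebraMap j₁.fieldRange (AlgebraicClosure F) (e₁ m) := rfl
  rw [AlgEquiv.coe_ofBijective, h1, AlgHom.liftNormal_commutes]
  change j₂ (e₁.symm (e₁ m)) = j₂ m
  rw [e₁.symm_apply_apply]

/-! ### §2 The compositum `e(M)·F_n ⊆ F̄` and the layer `(M·F_∞)_n ⊆ M̄` -/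

omit [Fact p.Prime] in
/-- Membership in a layer: `x ∈ K_n ↔ τ • x = x` for all `τ ∈ κ⁻¹(pⁿℤ_p)`. [cite: Washington1997, §13.1] -/
private theorem mem_layer_iff_smul {K : Type v} [Field K] [Fact p.Prime] (κ : ZpExtension K p) (n : ℕ)
    (x : AlgebraicClosure K) : x ∈ κ.layer n ↔ ∀ τ ∈ κ.layerSubgroup n, τ • x = x := by
  rw [layer, IntermediateField.mem_fixedField_iff]
  constructor
  · intro h τ hτ
    exact h _ ⟨τ, hτ, rfl⟩
  · rintro h f ⟨τ, hτ, rfl⟩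
    exact h τ hτ

variable [NumberField F]

/-- **`y ∈ e(M)·F_n` iff `y` is fixed by `res(Γ_M) ∩ κ⁻¹(pⁿℤ_p)`**, for the copy `e(M) = absEmbedding F M (M) ⊆ F̄`
whose pointwise stabiliser in `Γ_F` is `res(Γ_M)` (`range_absGaloisRestrict_eq_fixingSubgroup_absEmbedding`): by the
Krull–Galois correspondence for `F̄/F` the compositum `e(M) ⊔ F_n` is the fixed field of
`Gal(F̄/e(M)) ∩ Gal(F̄/F_n)` (`fixingSubgroup_sup`, `InfiniteGalois.fixedField_fixingSubgroup`), and
`Gal(F̄/F_n) = κ⁻¹(pⁿℤ_p)` (`fixingSubgroup_layer`). [cite: Washington1997, §13.1] -/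
theorem mem_fieldRange_sup_layer_iff (κ : ZpExtension F p) (M : Type v) [Field M] [Algebra F M]
    [Algebra.IsAlgebraic F M] (n : ℕ) (y : AlgebraicClosure F) :
    y ∈ (absEmbedding F M).fieldRange ⊔ κ.layer n ↔
      ∀ τ : absoluteGaloisGroup M, absGaloisRestrict F M τ ∈ κ.layerSubgroup n →
        absGaloisRestrict F M τ • y = y := by
  haveI : IsGalois F (AlgebraicClosure F) := IsAlgClosure.isGalois F _
  have hfix : y ∈ (absEmbedding F M).fieldRange ⊔ κ.layer n ↔
      ∀ g ∈ ((absEmbedding F M).fieldRange ⊔ κ.layer n).fixingSubgroup, g y = y := by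
    conv_lhs => rw [← InfiniteGalois.fixedField_fixingSubgroup ((absEmbedding F M).fieldRange ⊔ κ.layer n)]
    exact IntermediateField.mem_fixedField_iff _ y
  rw [hfix, IntermediateField.fixingSubgroup_sup, κ.fixingSubgroup_layer n]
  have hrange := range_absGaloisRestrict_eq_fixingSubgroup_absEmbedding F M
  constructor
  · intro h τ hτ
    refine h (absoluteGaloisGroup.toAlgEquiv F (absGaloisRestrict F M τ)) (Subgroup.mem_inf.mpr ⟨?_, ?_⟩)
    · have hmem : absGaloisRestrict F M τ ∈ (absGaloisRestrict F M).range := ⟨τ, rfl⟩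
      rw [hrange] at hmem
      exact hmem
    · exact Subgroup.mem_map_of_mem _ hτ
  · intro h g hg
    obtain ⟨hg₁, hg₂⟩ := Subgroup.mem_inf.mp hg
    have hg₁' : (absoluteGaloisGroup.toAlgEquiv F).symm g ∈ (absGaloisRestrict F M).range := by
      rw [hrange]
      exact hg₁
    obtain ⟨τ, hτ⟩ := hg₁'
    have hτ' : absGaloisRestrict F M τ = (absoluteGaloisGroup.toAlgEquiv F).symm g := hτ
    rw [Subgroup.mem_map_equiv] at hg₂
    have key := h τ (hτ' ▸ hg₂)
    rw [hτ'] at key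
    exact key

omit [NumberField F] in
/-- **`ι y ∈ (M·F_∞)_n` iff `y` is fixed by `res(Γ_M) ∩ κ⁻¹(pⁿℤ_p)`**, for the chosen `ι = absClosureEquiv F M : F̄ ≅ M̄`
along which `res` is defined (`ι (res τ • y) = τ • ι y`): the layer subgroup of `κ.restrict M h` is `res⁻¹(κ⁻¹(pⁿℤ_p))`
(`layerSubgroup_restrict`). [cite: Washington1997, §13.1] -/
theorem absClosureEquiv_mem_layer_restrict_iff (κ : ZpExtension F p) (M : Type v) [Field M] [NumberField M]
    [Algebra F M] [Algebra.IsAlgebraic F M]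
    (h : Function.Surjective (κ.toContinuousMonoidHom.comp (absGaloisRestrict F M))) (n : ℕ)
    (y : AlgebraicClosure F) :
    absClosureEquiv F M y ∈ (κ.restrict M h).layer n ↔
      ∀ τ : absoluteGaloisGroup M, absGaloisRestrict F M τ ∈ κ.layerSubgroup n →
        absGaloisRestrict F M τ • y = y := by
  rw [mem_layer_iff_smul, layerSubgroup_restrict]
  refine forall_congr' fun τ => ?_
  rw [Subgroup.mem_comap]
  refine imp_congr Iff.rfl ?_
  rw [absClosureEquiv_apply, ← absGaloisRestrict_apply_smul]
  exact (absClosureEmbedding_bijective F M).1.eq_iff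

/-- **`(M·F_∞)_n ≅ e(M)·F_n`** as rings, for the copy `e(M) ⊆ F̄` (`absEmbedding`): the chosen `ι : F̄ ≅ M̄` maps the
compositum `e(M) ⊔ F_n ⊆ F̄` onto the `n`-th layer of `κ.restrict M h` in `M̄` (the two membership criteria above
coincide). [cite: Washington1997, §13.1] -/
theorem nonempty_ringEquiv_fieldRange_sup_layer_layer_restrict (κ : ZpExtension F p) (M : Type v) [Field M]
    [NumberField M] [Algebra F M] [Algebra.IsAlgebraic F M]
    (h : Function.Surjective (κ.toContinuousMonoidHom.comp (absGaloisRestrict F M))) (n : ℕ) :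
    Nonempty (↥((absEmbedding F M).fieldRange ⊔ κ.layer n) ≃+* ↥((κ.restrict M h).layer n)) := by
  set θ := absClosureEquiv F M with hθ
  have hmem : ∀ y : AlgebraicClosure F,
      y ∈ (absEmbedding F M).fieldRange ⊔ κ.layer n ↔ θ y ∈ (κ.restrict M h).layer n := fun y =>
    (mem_fieldRange_sup_layer_iff κ M n y).trans (absClosureEquiv_mem_layer_restrict_iff κ M h n y).symm
  have hmem' : ∀ x : AlgebraicClosure M,
      x ∈ (κ.restrict M h).layer n ↔ θ.symm x ∈ (absEmbedding F M).fieldRange ⊔ κ.layer n := fun x => by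
    rw [hmem, θ.apply_symm_apply]
  exact ⟨{ toFun := fun y => ⟨θ y, (hmem y).mp y.2⟩
           invFun := fun x => ⟨θ.symm x, (hmem' x).mp x.2⟩
           left_inv := fun y => Subtype.ext (θ.symm_apply_apply y)
           right_inv := fun x => Subtype.ext (θ.apply_symm_apply x)
           map_mul' := fun y y' => Subtype.ext (map_mul θ y.1 y'.1)
           map_add' := fun y y' => Subtype.ext (map_add θ y.1 y'.1) }⟩

/-! ### §3 Any embedding: `(M·F_∞)_n ≅ j(M)·F_n` -/

/-- The layers `F_n ⊆ F̄` are stable under `Gal(F̄/F)` (they are Galois over `F`, `isGalois_layer_holds`).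
[cite: Washington1997, §13.1] -/
theorem map_algEquiv_layer (κ : ZpExtension F p) (n : ℕ) (τ : AlgebraicClosure F ≃ₐ[F] AlgebraicClosure F) :
    (κ.layer n).map (τ : AlgebraicClosure F →ₐ[F] AlgebraicClosure F) = κ.layer n := by
  haveI : IsGalois F (κ.layer n) := κ.isGalois_layer_holds n
  exact IntermediateField.normal_iff_forall_map_eq'.mp (inferInstance : Normal F (κ.layer n)) τ

/-- For `τ ∈ Gal(F̄/F)` with `τ ∘ j₁ = j₂`: **`τ(j₁(M)·F_n) = j₂(M)·F_n`**, whence `j₁(M)·F_n ≃ₐ[F] j₂(M)·F_n`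
(`τ` maps `j₁(M)` to `j₂(M)` and fixes the normal subfield `F_n`). [cite: Washington1997, §13.1]
[cite: MilneFT2022, Ch. 7 (embeddings into the algebraic closure are conjugate under the absolute Galois group)] -/
theorem nonempty_algEquiv_fieldRange_sup_layer_of_apply_eq (κ : ZpExtension F p) {M : Type v} [Field M]
    [Algebra F M] (j₁ j₂ : M →ₐ[F] AlgebraicClosure F) (τ : AlgebraicClosure F ≃ₐ[F] AlgebraicClosure F)
    (hτ : ∀ m : M, τ (j₁ m) = j₂ m) (n : ℕ) :
    Nonempty (↥(j₁.fieldRange ⊔ κ.layer n) ≃ₐ[F] ↥(j₂.fieldRange ⊔ κ.layer n)) := by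
  have hcomp : (τ : AlgebraicClosure F →ₐ[F] AlgebraicClosure F).comp j₁ = j₂ := AlgHom.ext hτ
  have hmap : (j₁.fieldRange ⊔ κ.layer n).map (τ : AlgebraicClosure F →ₐ[F] AlgebraicClosure F) =
      j₂.fieldRange ⊔ κ.layer n := by
    rw [IntermediateField.map_sup, AlgHom.map_fieldRange, hcomp, map_algEquiv_layer]
  exact ⟨(IntermediateField.equivMap (j₁.fieldRange ⊔ κ.layer n)
    (τ : AlgebraicClosure F →ₐ[F] AlgebraicClosure F)).trans (IntermediateField.equivOfEq hmap)⟩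

/-- **The `n`-th layer of `M·F_∞/M` is the compositum `j(M)·F_n ⊆ F̄`, for every `F`-embedding `j : M → F̄`:**
`(κ.restrict M h).layer n ≃+* ↥(j.fieldRange ⊔ κ.layer n)`.  (Washington §13.1: the layers of `K_∞L/L` are the `LK_n`
when `L ∩ K_∞ = K`, which the surjectivity `h` expresses; for `j = absEmbedding F M` this is
`nonempty_ringEquiv_fieldRange_sup_layer_layer_restrict`, and any other `j` is conjugate to it by an element of `Gal(F̄/F)`,
`exists_algEquiv_apply_eq`, which preserves `F_n`.) [cite: Washington1997, §13.1] -/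
theorem nonempty_ringEquiv_layer_restrict_fieldRange_sup_layer (κ : ZpExtension F p) (M : Type v) [Field M]
    [NumberField M] [Algebra F M]
    (h : Function.Surjective (κ.toContinuousMonoidHom.comp (absGaloisRestrict F M)))
    (j : M →ₐ[F] AlgebraicClosure F) (n : ℕ) :
    Nonempty (↥((κ.restrict M h).layer n) ≃+* ↥(j.fieldRange ⊔ κ.layer n)) := by
  haveI : FiniteDimensional F M := Module.Finite.of_restrictScalars_finite ℚ F M
  obtain ⟨e₁⟩ := nonempty_ringEquiv_fieldRange_sup_layer_layer_restrict κ M h n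
  obtain ⟨τ, hτ⟩ := exists_algEquiv_apply_eq (absEmbedding F M) j
  obtain ⟨e₂⟩ := nonempty_algEquiv_fieldRange_sup_layer_of_apply_eq κ (absEmbedding F M) j τ hτ n
  exact ⟨e₁.symm.trans e₂.toRingEquiv⟩

/-- **`#Cl((M·F_∞)_n) = #Cl(j(M)·F_n)`**: the class group of the `n`-th layer of the restricted tower is that of the
compositum `j(M)·F_n ⊆ F̄`, for every `F`-embedding `j : M → F̄` (class groups along a ring isomorphism,
`ClassGroup.mulEquiv ∘ RingOfIntegers.mapRingEquiv`).  This is the identification through which a class-number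
relation in the layer `L·F_n/F_n` — whose intermediate fields are the `L^{H}·F_n` — becomes a relation between the
exponents `e_n` of the restricted towers `L^{H}·F_∞/L^{H}` (`IwasawaTheory.classNumberPExp`). [cite: Washington1997, §13.1] -/
theorem natCard_classGroup_layer_restrict_eq (κ : ZpExtension F p) (M : Type v) [Field M] [NumberField M]
    [Algebra F M] (h : Function.Surjective (κ.toContinuousMonoidHom.comp (absGaloisRestrict F M)))
    (j : M →ₐ[F] AlgebraicClosure F) (n : ℕ) :
    Nat.card (ClassGroup (𝓞 ↥((κ.restrict M h).layer n))) =
      Nat.card (ClassGroup (𝓞 ↥(j.fieldRange ⊔ κ.layer n))) := by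
  obtain ⟨e⟩ := nonempty_ringEquiv_layer_restrict_fieldRange_sup_layer κ M h j n
  exact Nat.card_congr (ClassGroup.mulEquiv (NumberField.RingOfIntegers.mapRingEquiv e)).toEquiv

end Literature.NumberTheory.EllipticCurves.ZpExtension

end
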